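import Literature.Computability.Complexity.DirectProductDecoding
import HarnessLib

/-!
# Uniform direct-product decoding (IJKW), II: the sampler arguments

Trunk T-CPLX-CORE, continuation of `DirectProductDecoding.lean` (fourth instalment of the
decomposition of `Literature.Computability.Learning.cikk_natural_implies_learning`). Here: the
two uses of the sampling property of the `T`-graph (random completions of a trusted partial
tuple sample the universe well, by Hoeffding's inequality on the FREE coordinates):

* `card_upperDeviation_sum_on_le_exp` / `card_lowerDeviation_sum_on_le_exp` — Hoeffding's
  inequality in counting form for the sum of a `[0,1]`-valued function over a SUBSET `T` of the
  coordinates of a uniform `ω : ι → α` (the coordinate-subset form of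
  `card_upperDeviation_sum_le_exp`, same proof from Mathlib's sub-Gaussian Hoeffding bound);
* the `T`-graph bookkeeping: `edges P a = Pᶜ ×ˢ Cons` (pairs (free position, consistent
  completion)), the Cons-degree `consCnt x` and red degree `redCnt x` of a point `x`, the error
  fraction `errFrac x = redCnt x / consCnt x` (IJKW's `h(x)`), and the regrouping identities
  `sum_cons_sum_compl_eq` (edge sums by endpoint) and `sum_redCnt_eq_consErr`;
* IJKW Lemma 3.9 (`card_starved_le`): for a good row, at most `β|U|` points have Cons-degree
  below `ε'/4` of the maximum; IJKW Lemma 3.10 (`sum_errFrac_le`): for an excellent row,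
  `Σ_x h(x) ≤ max(4α, β)|U|`. Constants: `λ = exp(-(k-s)β²/2) ≤ ε'/2` replaces IJKW's
  `(β, λ)`-sampler hypothesis (additive Hoeffding instead of the multiplicative Chernoff bound,
  which only changes constants).

## References

* R. Impagliazzo, R. Jaiswal, V. Kabanets, A. Wigderson, *Uniform direct product theorems:
  simplified, optimized, and derandomized*, SIAM J. Comput. 39(4) (2010), Lemmas 2.1, 2.12,
  2.13, 2.14, 3.9, 3.10 [ImpagliazzoEtAl2010].
* W. Hoeffding, *Probability inequalities for sums of bounded random variables*, JASA 58 (1963).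
-/

open Finset Real MeasureTheory ProbabilityTheory

namespace Literature.Computability.Complexity

/-! ### Hoeffding on a subset of the coordinates -/

/-- **Hoeffding, upper tail, `[0,1]`-valued, on a coordinate subset `T`.** For `F : α → [0,1]`
with average `a`, among the uniform `ω : ι → α` those with `Σ_{i ∈ T} F(ωᵢ) ≥ |T| a + |T| η`
number at most `exp(-2|T|η²) · |α|^|ι|` (`T` nonempty, `η ≥ 0`). [folklore] -/
theorem card_upperDeviation_sum_on_le_exp {ι α : Type*} [Fintype ι] [DecidableEq ι] [Fintype α]
    [Nonempty α] (T : Finset ι) (hT : 0 < T.card) (F : α → ℝ)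
    (hF : ∀ a, F a ∈ Set.Icc (0 : ℝ) 1) {η : ℝ} (hη : 0 ≤ η) :
    ((univ.filter fun ω : ι → α => (T.card : ℝ) * η ≤
        (∑ i ∈ T, F (ω i)) - T.card * ((∑ a, F a) / Fintype.card α)).card : ℝ) ≤
      exp (-2 * T.card * η ^ 2) * Fintype.card (ι → α) := by
  classical
  letI : MeasurableSpace α := ⊤
  haveI : MeasurableSingletonClass α := ⟨fun _ => MeasurableSpace.measurableSet_top⟩
  set μ : Measure α := uniformOn (Set.univ : Set α) with hμ
  haveI : IsProbabilityMeasure μ :=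
    isProbabilityMeasure_uniformOn Set.finite_univ Set.univ_nonempty
  set X : α → ℝ := F with hX
  have hXmeas : Measurable X := measurable_of_finite X
  have hXbdd : ∀ᵐ a ∂μ, X a ∈ Set.Icc (0 : ℝ) 1 := ae_of_all _ fun a => hF a
  have hXLp : MemLp X 2 μ := memLp_of_bounded hXbdd hXmeas.aestronglyMeasurable 2
  set p : ℝ := (∑ a, F a) / Fintype.card α with hp
  have hmean : μ[X] = p := by
    rw [integral_fintype (MemLp.integrable (by norm_num) hXLp)]
    have hsing : ∀ a : α, μ.real {a} = (Fintype.card α : ℝ)⁻¹ := fun a => by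
      rw [measureReal_def, hμ, uniformOn_univ, Measure.count_singleton]
      simp [ENNReal.toReal_inv]
    simp only [hsing, smul_eq_mul, ← Finset.mul_sum]
    rw [inv_mul_eq_div, hp]
  have hsg : HasSubgaussianMGF (fun a => X a - μ[X]) ((‖(1 : ℝ) - 0‖₊ / 2) ^ 2) μ :=
    hasSubgaussianMGF_of_mem_Icc hXmeas.aemeasurable hXbdd
  set P : Measure (ι → α) := Measure.pi fun _ : ι => μ with hP
  have hPunif : uniformOn (Set.univ : Set (ι → α)) = P := by
    rw [hP, ← uniformOn_pi, Set.pi_univ]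
  set Y : ι → (ι → α) → ℝ := fun i ω => X (ω i) - μ[X] with hY
  have hind : iIndepFun Y P :=
    iIndepFun_pi (X := fun (_ : ι) (a : α) => X a - μ[X]) fun _ =>
      (hXmeas.sub_const _).aemeasurable
  have hsgi : ∀ i ∈ T, HasSubgaussianMGF (Y i) ((‖(1 : ℝ) - 0‖₊ / 2) ^ 2) P := by
    intro i _
    exact HasSubgaussianMGF.of_map (μ := P) (Y := fun ω : ι → α => ω i)
      (X := fun a => X a - μ[X]) (measurable_pi_apply i).aemeasurable
      (by rw [(measurePreserving_eval (fun _ : ι => μ) i).map_eq]; exact hsg)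
  have hhoeff := HasSubgaussianMGF.measure_sum_ge_le_of_iIndepFun hind hsgi
    (ε := (T.card : ℝ) * η) (by positivity)
  set B : Finset (ι → α) := univ.filter fun ω : ι → α => (T.card : ℝ) * η ≤
    (∑ i ∈ T, F (ω i)) - T.card * p with hB
  have hsum : ∀ ω : ι → α, (∑ i ∈ T, Y i ω) = (∑ i ∈ T, F (ω i)) - T.card * p := by
    intro ω
    simp only [hY, Finset.sum_sub_distrib, Finset.sum_const, nsmul_eq_mul]
    rw [hmean]
  have hBset : (B : Set (ι → α)) = {ω | (T.card : ℝ) * η ≤ ∑ i ∈ T, Y i ω} := by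
    ext ω
    simp only [Finset.coe_filter, Finset.mem_univ, true_and, Set.mem_setOf_eq, hsum ω, hB]
  have hPB : P.real B ≤ exp (-2 * T.card * η ^ 2) := by
    rw [hBset]
    refine hhoeff.trans (le_of_eq ?_)
    congr 1
    simp only [Finset.sum_const, nsmul_eq_mul]
    have : ((‖(1 : ℝ) - 0‖₊ / 2) ^ 2 : NNReal) = (1 / 4 : ℝ) := by
      rw [sub_zero, nnnorm_one]; push_cast; norm_num
    rw [NNReal.coe_mul, this]
    have hm' : (T.card : ℝ) ≠ 0 := by exact_mod_cast hT.ne'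
    push_cast
    field_simp
    ring
  have hPB' : P.real B = (B.card : ℝ) / Fintype.card (ι → α) := by
    rw [measureReal_def, ← hPunif, uniformOn_univ, Measure.count_apply_finset,
      ENNReal.toReal_div, ENNReal.toReal_natCast, ENNReal.toReal_natCast]
  rw [hPB'] at hPB
  have hN : (0 : ℝ) < Fintype.card (ι → α) := by exact_mod_cast Fintype.card_pos
  rwa [div_le_iff₀ hN] at hPB

/-- **Hoeffding, lower tail, `[0,1]`-valued, on a coordinate subset `T`**: those `ω` with
`Σ_{i ∈ T} F(ωᵢ) ≤ |T| a - |T| η` number at most `exp(-2|T|η²) · |α|^|ι|`. [folklore] -/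
theorem card_lowerDeviation_sum_on_le_exp {ι α : Type*} [Fintype ι] [DecidableEq ι] [Fintype α]
    [Nonempty α] (T : Finset ι) (hT : 0 < T.card) (F : α → ℝ)
    (hF : ∀ a, F a ∈ Set.Icc (0 : ℝ) 1) {η : ℝ} (hη : 0 ≤ η) :
    ((univ.filter fun ω : ι → α => (∑ i ∈ T, F (ω i)) ≤
        T.card * ((∑ a, F a) / Fintype.card α) - T.card * η).card : ℝ) ≤
      exp (-2 * T.card * η ^ 2) * Fintype.card (ι → α) := by
  classical
  have h := card_upperDeviation_sum_on_le_exp T hT (fun a => 1 - F a)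
    (fun a => ⟨by linarith [(hF a).2], by linarith [(hF a).1]⟩) hη
  refine le_trans (le_of_eq ?_) h
  congr 2
  ext ω
  simp only [mem_filter, mem_univ, true_and]
  have hN : (0 : ℝ) < Fintype.card α := Nat.cast_pos.2 Fintype.card_pos
  rw [Finset.sum_sub_distrib, Finset.sum_const, nsmul_eq_mul, mul_one, Finset.sum_sub_distrib,
    Finset.sum_const, card_univ, nsmul_eq_mul, mul_one, sub_div, div_self hN.ne']
  constructor <;> intro h <;> nlinarith [h]

namespace DirectProduct

variable {U R : Type*} [Fintype U] [DecidableEq U] [DecidableEq R] {k : ℕ}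
variable (C : (Fin k → U) → Fin k → R) (f : U → R)

/-! ### The `T`-graph of a row: edges, Cons-degrees, red degrees -/

/-- The edges of IJKW's `T`-graph restricted to consistent completions: pairs
(free position `j`, consistent completion `y`); the edge joins the point `y j` to `y`.
[cite: ImpagliazzoEtAl2010, Def. 2.8] -/
def edges (P : Finset (Fin k)) (a : Fin k → U) : Finset (Fin k × (Fin k → U)) :=
  Pᶜ ×ˢ cons C f P a

/-- The **Cons-degree** of a point `x`: edges `(j, y)` with `y j = x`.
[cite: ImpagliazzoEtAl2010, Lemma 3.9] -/
def consCnt (P : Finset (Fin k)) (a : Fin k → U) (x : U) : ℕ :=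
  ((edges C f P a).filter fun e => e.2 e.1 = x).card

/-- The **red degree** of a point `x`: Cons-edges at `x` on which `C` errs at the position of `x`
(IJKW, proof of Lemma 3.10: red edges). [cite: ImpagliazzoEtAl2010, Lemma 3.10 (proof)] -/
def redCnt (P : Finset (Fin k)) (a : Fin k → U) (x : U) : ℕ :=
  ((edges C f P a).filter fun e => e.2 e.1 = x ∧ C (fill P a e.2) e.1 ≠ f x).card

/-- IJKW's `h(x)`: the fraction of red edges among the Cons-edges at `x` (`0` if there are
none). [cite: ImpagliazzoEtAl2010, Lemma 3.10] -/
noncomputable def errFrac (P : Finset (Fin k)) (a : Fin k → U) (x : U) : ℝ :=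
  redCnt C f P a x / consCnt C f P a x

/-- Red edges are Cons-edges. [folklore] -/
theorem redCnt_le_consCnt (P : Finset (Fin k)) (a : Fin k → U) (x : U) :
    redCnt C f P a x ≤ consCnt C f P a x :=
  card_le_card (monotone_filter_right _ fun _ _ h => h.1)

/-- `h(x) ∈ [0,1]`. [folklore] -/
theorem errFrac_mem_Icc (P : Finset (Fin k)) (a : Fin k → U) (x : U) :
    errFrac C f P a x ∈ Set.Icc (0 : ℝ) 1 := by
  unfold errFrac
  refine ⟨by positivity, ?_⟩
  rcases Nat.eq_zero_or_pos (consCnt C f P a x) with h | h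
  · simp [h]
  · rw [div_le_one (by exact_mod_cast h)]
    exact_mod_cast redCnt_le_consCnt C f P a x

/-- `h(x) · consCnt(x) = redCnt(x)`. [folklore] -/
theorem errFrac_mul_consCnt (P : Finset (Fin k)) (a : Fin k → U) (x : U) :
    errFrac C f P a x * consCnt C f P a x = redCnt C f P a x := by
  unfold errFrac
  rcases Nat.eq_zero_or_pos (consCnt C f P a x) with h | h
  · have h0 : redCnt C f P a x = 0 := Nat.eq_zero_of_le_zero (h ▸ redCnt_le_consCnt C f P a x)
    simp [h, h0]
  · rw [div_mul_cancel₀]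
    exact_mod_cast h.ne'

/-- **Regrouping edge sums by endpoint**: summing a weight of the endpoint `y j` over all
Cons-edges `(j, y)` is summing the weight against the Cons-degrees.
[cite: ImpagliazzoEtAl2010, Lemma 2.14 (proof, double counting)] -/
theorem sum_cons_sum_compl_eq (P : Finset (Fin k)) (a : Fin k → U) (w : U → ℝ) :
    ∑ y ∈ cons C f P a, ∑ j ∈ Pᶜ, w (y j) = ∑ x, w x * consCnt C f P a x := by
  have h1 : ∑ y ∈ cons C f P a, ∑ j ∈ Pᶜ, w (y j) = ∑ e ∈ edges C f P a, w (e.2 e.1) := by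
    rw [edges, Finset.sum_product, Finset.sum_comm]
  rw [h1, ← Finset.sum_fiberwise_of_maps_to (s := edges C f P a) (t := univ)
    (g := fun e => e.2 e.1) (fun _ _ => mem_univ _)]
  refine Finset.sum_congr rfl fun x _ => ?_
  rw [consCnt, mul_comm, ← nsmul_eq_mul, ← Finset.sum_const]
  exact Finset.sum_congr rfl fun e he => by rw [(mem_filter.1 he).2]

omit [DecidableEq U] in
/-- For a consistent completion, the error set lies in the free positions, where the completion
reads `y`. [folklore] -/
theorem errSet_fill_eq_of_mem_cons {P : Finset (Fin k)} {a y : Fin k → U} (hy : y ∈ cons C f P a) :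
    errSet C f (fill P a y) = Pᶜ.filter fun j => C (fill P a y) j ≠ f (y j) := by
  rw [mem_cons] at hy
  ext j
  simp only [mem_errSet, mem_filter, mem_compl]
  by_cases hj : j ∈ P
  · constructor
    · intro h
      exact absurd ((mem_errSet C f).2 h) (Finset.disjoint_left.1 hy hj)
    · exact fun h => absurd hj h.1
  · simp [hj]

/-- **The red edges are the errors of the consistent completions**:
`Σ_x redCnt(x) = consErr`. [cite: ImpagliazzoEtAl2010, Lemma 3.10 (proof)] -/
theorem sum_redCnt_eq_consErr (P : Finset (Fin k)) (a : Fin k → U) :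
    ∑ x, (redCnt C f P a x : ℝ) = consErr C f P a := by
  -- red edges, regrouped by endpoint
  have h1 : ∑ x, (redCnt C f P a x : ℝ) =
      ((edges C f P a).filter fun e => C (fill P a e.2) e.1 ≠ f (e.2 e.1)).card := by
    rw [card_eq_sum_card_fiberwise (f := fun e : Fin k × (Fin k → U) => e.2 e.1) (t := univ)
      (fun _ _ => mem_univ _)]
    push_cast
    refine Finset.sum_congr rfl fun x _ => ?_
    rw [redCnt, filter_filter]
    congr 2
    ext e
    simp only [mem_filter]
    constructor
    · rintro ⟨h0, h1, h2⟩; exact ⟨h0, by rw [h1]; exact h2, h1⟩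
    · rintro ⟨h0, h1, h2⟩; exact ⟨h0, h2, by rw [← h2]; exact h1⟩
  -- count the red edges completion by completion
  have h2 : ∀ y ∈ cons C f P a, ((errSet C f (fill P a y)).card : ℝ) =
      ∑ j ∈ Pᶜ, if C (fill P a y) j ≠ f (y j) then (1 : ℝ) else 0 := by
    intro y hy
    rw [errSet_fill_eq_of_mem_cons C f hy, Finset.sum_boole, natCast_card_filter, Finset.sum_boole]
  rw [h1, edges, natCast_card_filter, Finset.sum_product, Finset.sum_comm, consErr]
  push_cast
  exact Finset.sum_congr rfl fun y hy => (h2 y hy).symm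

/-! ### IJKW Lemmas 3.9 and 3.10 -/

omit [DecidableEq U] in
/-- `|Pᶜ| = k - s` for a position set of size `s`. [folklore] -/
theorem card_compl_eq {s : ℕ} (hsk : s < k) {P : Finset (Fin k)} (hP : P.card = s) :
    (Pᶜ.card : ℝ) = k - s := by
  rw [Finset.card_compl, Fintype.card_fin, hP, Nat.cast_sub hsk.le]

omit [DecidableEq U] in
/-- Good rows have many consistent completions: `|Cons| ≥ ε' |U|^k`.
[cite: ImpagliazzoEtAl2010, §3.1] -/
theorem le_card_cons_of_good {ε' : ℝ} {P : Finset (Fin k)} {a : Fin k → U}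
    (hg : Good C f ε' P a) : ε' * Fintype.card (Fin k → U) ≤ (cons C f P a).card :=
  hg.trans (by exact_mod_cast card_le_card (corr_subset_cons C f P a))

/-- The sampling step shared by IJKW Lemmas 3.9 and 3.10: for a good row and a weight
`w : U → [0,1]` of average `μ > β`, with `exp(-(k-s)β²/2) ≤ ε'/2`, the edge sum
`Σ_{y ∈ Cons} Σ_{j ∉ P} w(y j)` is at least `(ε'/4)|U|^k (k-s) μ` (all but `ε'/2 · |U|^k`
completions sample `w` within a factor `2`, by Hoeffding on the free coordinates, and
`|Cons| ≥ ε'|U|^k`). [cite: ImpagliazzoEtAl2010, Lemmas 2.13–2.14 (proofs)] -/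
theorem edgeSum_ge [Nonempty U] {s : ℕ} (hsk : s < k) {P : Finset (Fin k)} (hP : P.card = s)
    {a : Fin k → U} {ε' β : ℝ} (hβ : 0 < β) (hgood : Good C f ε' P a)
    (H2 : exp (-((k - s) * β ^ 2 / 2)) ≤ ε' / 2) (w : U → ℝ) (hw : ∀ u, w u ∈ Set.Icc (0 : ℝ) 1)
    (hμ : β < (∑ u, w u) / Fintype.card U) :
    ((cons C f P a).card : ℝ) / 4 * (k - s) * ((∑ u, w u) / Fintype.card U) ≤
      ∑ y ∈ cons C f P a, ∑ j ∈ Pᶜ, w (y j) := by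
  classical
  set μ : ℝ := (∑ u, w u) / Fintype.card U with hμdef
  set K : ℝ := (Fintype.card (Fin k → U) : ℝ) with hKdef
  have hK : 0 < K := Nat.cast_pos.2 Fintype.card_pos
  have hT := card_compl_eq hsk hP
  have hks : (0 : ℝ) < k - s := by
    have : (s : ℝ) < k := by exact_mod_cast hsk
    linarith
  have hTpos : 0 < Pᶜ.card := by
    have : (0 : ℝ) < Pᶜ.card := by rw [hT]; exact hks
    exact_mod_cast this
  have hμpos : 0 < μ := hβ.trans hμ
  -- the badly sampling completions are few
  set Bad := univ.filter fun y : Fin k → U =>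
    (∑ j ∈ Pᶜ, w (y j)) ≤ Pᶜ.card * μ - Pᶜ.card * (μ / 2) with hBad
  have hBadle : (Bad.card : ℝ) ≤ ε' / 2 * K := by
    have h := card_lowerDeviation_sum_on_le_exp (ι := Fin k) (α := U) Pᶜ hTpos w hw
      (η := μ / 2) (by positivity)
    refine h.trans (mul_le_mul_of_nonneg_right (le_trans ?_ H2) hK.le)
    rw [exp_le_exp, hT]
    have hμβ : β ^ 2 ≤ μ ^ 2 := by nlinarith
    nlinarith [mul_le_mul_of_nonneg_left hμβ hks.le]
  -- outside Bad, a completion samples at least half the average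
  have hgoodY : ∀ y, y ∉ Bad → (k - s) * (μ / 2) ≤ ∑ j ∈ Pᶜ, w (y j) := by
    intro y hy
    rw [hBad, mem_filter, not_and] at hy
    have h := not_le.1 (hy (mem_univ _))
    rw [hT] at h
    linarith
  have hcons := le_card_cons_of_good C f hgood
  have hsd : ((cons C f P a).card : ℝ) - Bad.card ≤ ((cons C f P a) \ Bad).card := by
    have := Finset.card_le_card_sdiff_add_card (s := cons C f P a) (t := Bad)
    have h' : ((cons C f P a).card : ℝ) ≤ ((cons C f P a) \ Bad).card + Bad.card := by
      exact_mod_cast this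
    linarith
  calc ((cons C f P a).card : ℝ) / 4 * (k - s) * μ
      ≤ (((cons C f P a).card : ℝ) - Bad.card) * ((k - s) * (μ / 2)) := by
        nlinarith [mul_nonneg hks.le hμpos.le]
    _ ≤ ((cons C f P a) \ Bad).card * ((k - s) * (μ / 2)) :=
        mul_le_mul_of_nonneg_right hsd (by positivity)
    _ = ∑ _y ∈ (cons C f P a) \ Bad, (k - s) * (μ / 2) := by
        rw [Finset.sum_const, nsmul_eq_mul]
    _ ≤ ∑ y ∈ (cons C f P a) \ Bad, ∑ j ∈ Pᶜ, w (y j) :=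
        Finset.sum_le_sum fun y hy => hgoodY y (mem_sdiff.1 hy).2
    _ ≤ ∑ y ∈ cons C f P a, ∑ j ∈ Pᶜ, w (y j) :=
        Finset.sum_le_sum_of_subset_of_nonneg sdiff_subset fun y _ _ =>
          Finset.sum_nonneg fun j _ => (hw _).1

/-- **IJKW Lemma 3.9** (true-value variant): for a good row, the points `x` whose Cons-degree
is below `ε'/4` of the maximal degree `(k-s)|U|^{k-1}` (i.e. `consCnt x · |U| < (ε'/4)(k-s)|U|^k`)
form at most a `β` fraction of `U`, provided `exp(-(k-s)β²/2) ≤ ε'/2`.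
[cite: ImpagliazzoEtAl2010, Lemma 3.9] -/
theorem card_starved_le [Nonempty U] {s : ℕ} (hsk : s < k) {P : Finset (Fin k)} (hP : P.card = s)
    {a : Fin k → U} {ε' β : ℝ} (hβ : 0 < β) (hgood : Good C f ε' P a)
    (H2 : exp (-((k - s) * β ^ 2 / 2)) ≤ ε' / 2) :
    ((univ.filter fun x : U => (consCnt C f P a x : ℝ) * Fintype.card U <
        ε' / 4 * (k - s) * Fintype.card (Fin k → U)).card : ℝ) ≤ β * Fintype.card U := by
  classical
  set N : ℝ := (Fintype.card U : ℝ) with hNdef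
  set K : ℝ := (Fintype.card (Fin k → U) : ℝ) with hKdef
  have hN : 0 < N := Nat.cast_pos.2 Fintype.card_pos
  set F := univ.filter fun x : U => (consCnt C f P a x : ℝ) * N < ε' / 4 * (k - s) * K with hFdef
  by_contra hcon
  rw [not_le] at hcon
  -- the weight: indicator of `F`, of average `μ = |F|/|U| > β`
  set w : U → ℝ := fun u => if u ∈ F then 1 else 0 with hwdef
  have hw : ∀ u, w u ∈ Set.Icc (0 : ℝ) 1 := fun u => by
    simp only [hwdef]; split_ifs <;> norm_num
  have hsumw : ∑ u, w u = F.card := by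
    simp only [hwdef, Finset.sum_boole, Finset.filter_univ_mem]
  have hμ : β < (∑ u, w u) / Fintype.card U := by
    rw [hsumw, lt_div_iff₀ hN]; linarith
  have hFne : F.Nonempty := by
    rw [← Finset.card_pos]
    have : (0 : ℝ) < F.card := lt_trans (mul_pos hβ hN) hcon
    exact_mod_cast this
  -- lower bound on the edge sum (sampling)
  have hlow := edgeSum_ge C f hsk hP hβ hgood H2 w hw hμ
  -- the edge sum is `Σ_{x ∈ F} consCnt x`, small by definition of `F`
  have hup : (∑ y ∈ cons C f P a, ∑ j ∈ Pᶜ, w (y j)) * N < F.card * (ε' / 4 * (k - s) * K) := by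
    rw [sum_cons_sum_compl_eq C f P a w]
    have : ∑ x, w x * (consCnt C f P a x : ℝ) = ∑ x ∈ F, (consCnt C f P a x : ℝ) := by
      simp only [hwdef, ite_mul, one_mul, zero_mul, Finset.sum_ite_mem, univ_inter]
    rw [this, Finset.sum_mul]
    calc ∑ x ∈ F, (consCnt C f P a x : ℝ) * N < ∑ _x ∈ F, ε' / 4 * (k - s) * K :=
          Finset.sum_lt_sum_of_nonempty hFne fun x hx => (mem_filter.1 hx).2
      _ = F.card * (ε' / 4 * (k - s) * K) := by rw [Finset.sum_const, nsmul_eq_mul]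
  rw [hsumw] at hlow
  have hcons := le_card_cons_of_good C f hgood
  have hks : (0 : ℝ) < k - s := by
    have : (s : ℝ) < k := by exact_mod_cast hsk
    linarith
  have hlow2 : ε' * K / 4 * (k - s) * (F.card / N) ≤
      ∑ y ∈ cons C f P a, ∑ j ∈ Pᶜ, w (y j) := by
    refine le_trans ?_ hlow
    have h0 : (0 : ℝ) ≤ (k - s) * (F.card / N) := by positivity
    nlinarith [mul_le_mul_of_nonneg_right hcons h0]
  have hlow' := mul_le_mul_of_nonneg_right hlow2 hN.le
  have : ε' * K / 4 * (k - s) * (F.card / N) * N = F.card * (ε' / 4 * (k - s) * K) := by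
    field_simp
  linarith

/-- **IJKW Lemma 3.10** (true-value variant): for an `α`-excellent row (with `|P| = s`),
`Σ_x h(x) ≤ max(4α, β) · |U|`, provided `exp(-(k-s)β²/2) ≤ ε'/2`.
[cite: ImpagliazzoEtAl2010, Lemma 3.10] -/
theorem sum_errFrac_le [Nonempty U] {s : ℕ} (hsk : s < k) {P : Finset (Fin k)} (hP : P.card = s)
    {a : Fin k → U} {ε' α β : ℝ} (hε' : 0 < ε') (hβ : 0 < β) (hexc : Excellent C f ε' α P a)
    (H2 : exp (-((k - s) * β ^ 2 / 2)) ≤ ε' / 2) :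
    ∑ x, errFrac C f P a x ≤ max (4 * α) β * Fintype.card U := by
  classical
  set N : ℝ := (Fintype.card U : ℝ) with hNdef
  set K : ℝ := (Fintype.card (Fin k → U) : ℝ) with hKdef
  have hN : 0 < N := Nat.cast_pos.2 Fintype.card_pos
  have hK : 0 < K := Nat.cast_pos.2 Fintype.card_pos
  by_contra hcon
  rw [not_le] at hcon
  set μ : ℝ := (∑ x, errFrac C f P a x) / N with hμdef
  have hμgt : max (4 * α) β < μ := by rw [hμdef, lt_div_iff₀ hN]; exact hcon
  have hμβ : β < μ := lt_of_le_of_lt (le_max_right _ _) hμgt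
  have hμα : 4 * α < μ := lt_of_le_of_lt (le_max_left _ _) hμgt
  have hks : (0 : ℝ) < k - s := by
    have : (s : ℝ) < k := by exact_mod_cast hsk
    linarith
  -- lower bound on the edge sum of `h` (sampling)
  have hlow := edgeSum_ge C f hsk hP hβ hexc.1 H2 (errFrac C f P a) (errFrac_mem_Icc C f P a) hμβ
  -- the edge sum of `h` is the number of red edges `= consErr ≤ α (k-s) |Cons|`
  have hup : ∑ y ∈ cons C f P a, ∑ j ∈ Pᶜ, errFrac C f P a (y j) ≤
      α * (k - s) * (cons C f P a).card := by
    rw [sum_cons_sum_compl_eq C f P a (errFrac C f P a)]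
    simp only [errFrac_mul_consCnt]
    rw [sum_redCnt_eq_consErr]
    have h := hexc.2
    rw [hP] at h
    exact h
  have hcons := le_card_cons_of_good C f hexc.1
  have hc0 : (0 : ℝ) < (cons C f P a).card := lt_of_lt_of_le (mul_pos hε' hK) hcons
  have h := hlow.trans hup
  -- `(|Cons|/4)(k-s) μ ≤ α (k-s) |Cons|` forces `μ ≤ 4α`
  have : μ ≤ 4 * α := by
    by_contra hlt
    rw [not_le] at hlt
    have := mul_lt_mul_of_pos_left hlt (mul_pos hc0 hks)
    nlinarith
  linarith

end DirectProduct

end Literature.Computability.Complexity
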